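import Summits.ABC.IUTFork.Cor312TwoPlacePins
import Summits.ABC.IUTFork.Repair.CandLana1
import Summits.ABC.IUTFork.Repair.CandJoshi1
import HarnessLib

/-!
# IUT REPAIR branch (rung LADDER-ABC:A2.RP) — the «2P» COLUMN, part 2 (seat abc-iut-rp-m4): the VOLUME rows RP-L01 (LANA (9-1), GLOBAL)
# and RP-J01b (Joshi's fundamental estimate, PACKETWISE) at the pinned two-place bed

Record file of the abc-iut cell's REPAIR branch (seat abc-iut-rp-m4; lead abc-iut-rp-plan). TAKES NO SIDE on [IUTchIII] Cor. 3.12 or on any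
author; PROOF-ONLY; the hypotheses evaluated are the typed CANDIDATES of `Repair/CandLana1` (abc-iut-w5-d182, p434743) and `Repair/CandJoshi1`
(abc-iut-rp-j1, p427582), never asserted. Companion of `Repair/TwoPlaceProfile` (p435676): the same split, now INSIDE the volume class — the
GLOBAL volume supplier RP-L01 (`CandLana1.H`: «some global possible image of the Θ-pilot has procession-normalised log-volume −|log(q)|»)
HOLDS at the two-place bed (`L01_holds`: the unique global image has volume `−2c = −|log(q)|`), while the PACKETWISE volume supplier RP-J01b
(`CandJoshi1.JoshiVolumeDominance`: at every packet SOME possible image has log-volume ≥ the q-term) FAILS there (`J01b_fails`: at the deep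
place, label `2`, the only possible image has volume `−4c < −c`). Bed: `Cor312TwoPlacePins` (p434789; two places, inflation `(0, 3)`, pins,
typed Thm. 3.11, bridge hypotheses, `|log(q)| > 0`, Statement TRUE, S/Licence FALSE). Neutral record of S. Mochizuki's (LcGlIq)/(EssGlIq) split
([Rpt2024-03] `paper:url-b58939b9dc8f` p. 7 l. 32–44) on two more rows; standard axioms only. [claim: Mochizuki2012, status: disputed]
-/

noncomputable section

open Set

namespace Summit.ABC.IUTFork.Repair.TwoPlaceProfile2

open Thm311 Cor312 Cor312Vol Cor312Vol.TwoPlace Cor312Vol.NaiveProv Literature.IUT.LogThetaLattice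

variable (p : ℕ) [hp : Fact p.Prime] (c : ℝ)

/-- At the two-place bed the possible images at a label of `𝔽_l^⋇` are the singleton of the packet hull (inflation in the region, cylinders
their own hulls). [folklore] -/
theorem two_possibleImages_eq_hull (d : twoIndex.VQ → ℕ) (i : Fin twoIndex.lstar) (vQ : twoIndex.VQ) :
    (twoSetting p c d).possibleImages (Setting.labelSucc i) vQ = {(twoSetting p c d).thetaHull (Setting.labelSucc i) vQ} := by
  rw [two_possibleImages, (two_thetaHull p c d _ vQ).1]

/-- ✓ **RP-L01** (`CandLana1.H`, LANA's (9-1) at the Cor.-3.12 level — a GLOBAL volume supplier): TRUE at 2P for every region reading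
(`−|log(Θ)| = −2c = −|log(q)|` there; `c > 0`). [folklore] -/
theorem L01_holds (hc : 0 < c)
    (ρ : (∀ v : twoIndex.V, v ∈ twoIndex.Vbad → Set ((signShells twoIndex).StarPacket v)) →
      ∀ (j : twoIndex.Label) (vQ : twoIndex.VQ), Set ((signShells twoIndex).Packet j vQ))
    (qK : ∀ v : twoIndex.V, v ∈ twoIndex.Vbad → Set ((signShells twoIndex).StarPacket v)) :
    CandLana1.H (twoFull p c).toLatticeSituation (twoSetting p c depth) ρ qK := by
  refine (CandLana1.H_iff_negLogTheta_eq (twoFull p c).toLatticeSituation (twoSetting p c depth) ρ qK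
    (two_bridgeHyps p c depth hc.le) (two_possibleImages_eq_hull p c depth)).2 ?_
  rw [two_negLogTheta, two_negLogQ, depth_val.1, depth_val.2]
  exact WithTop.coe_inj.2 (by push_cast; ring)

/-- ✗ **RP-J01b** (`CandJoshi1.JoshiVolumeDominance`, the fundamental estimate read PACKETWISE: at every packet some possible image has
log-volume ≥ the q-term): FALSE at 2P — at the deep place `0`, label `2`, the only possible image is `B_4` with volume `−4c < −c` (`c > 0`).
[folklore] -/
theorem J01b_fails (hc : 0 < c) : ¬ CandJoshi1.JoshiVolumeDominance (twoSetting p c depth) := by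
  intro h
  obtain ⟨U, hU, hvol⟩ := h 1 0
  rw [two_possibleImages, Set.mem_singleton_iff] at hU
  rw [hU, two_qLocal] at hvol
  have hv : ((twoFull p c).toLatticeSituation.D (twoSetting p c depth).n).logvol (Setting.labelSucc 1) 0
      (pBall p (Setting.labelSucc (T := twoIndex) 1) (0 : twoIndex.VQ)
        (jsq (T := twoIndex) (Setting.labelSucc (T := twoIndex) 1) - (depth 0 : ℕ))) =
      -((jsq (T := twoIndex) (Setting.labelSucc (T := twoIndex) 1) - (depth 0 : ℕ) : ℤ) : ℝ) * c :=
    volW_pBall p (fun _ : twoIndex.VQ => c) _ (0 : twoIndex.VQ) _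
  rw [hv, two_jsq.2, depth_val.1] at hvol
  push_cast at hvol
  linarith

/-- **The volume class splits too** (at `c = log p`): the GLOBAL volume supplier RP-L01 holds and the PACKETWISE volume supplier RP-J01b fails
at the pinned two-place bed, where the typed Statement holds and the residual S fails for the pinned reading. [folklore] -/
theorem volume_rows_split :
    CandLana1.H (twoFull p (Real.log p)).toLatticeSituation (twoSetting p (Real.log p) depth) (rho2 p depth)
        (qDatum p (0 : twoIndex.V) trivial (Real.log p)) ∧
      ¬ CandJoshi1.JoshiVolumeDominance (twoSetting p (Real.log p) depth) ∧
      Summit.ABC.IUTFork.Cor312.Setting.Statement (twoSetting p (Real.log p) depth) ∧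
      ¬ PilotKummerIndRelated (twoFull p (Real.log p)).toLatticeSituation (twoSetting p (Real.log p) depth) (rho2 p depth)
        (qDatum p (0 : twoIndex.V) trivial (Real.log p)) :=
  have hc : 0 < Real.log p := Real.log_pos (by exact_mod_cast hp.out.one_lt)
  ⟨L01_holds p _ hc _ _, J01b_fails p _ hc, two_statement p _ hc, two_pinned_not_S p _⟩

end Summit.ABC.IUTFork.Repair.TwoPlaceProfile2

end
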